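import Mathlib
import HarnessLib
import Summits.Ventures.LatticeQCDFlow.Exactness.FlowMCMC

/-!
# Exact independence Metropolis has nonnegative autocorrelations (the input of V9's positive part)

HONEST FRAMING: exact (Metropolis-corrected) sampling algorithms for lattice gauge theory;
figures of merit are autocorrelation/cost numbers at stated couplings and volumes; no
continuum-physics claim.

Venture `LatticeQCDFlow` (cell pub-lqcd), sub-topic `Scoring`; FANOUT row 11 (`eng-scorerA`,
fitness scorer A).  NEW WORK of the cell in the sense of the placement rule (our own elementary
proof on a finite state space); the fact itself is known — Liu (Statistics and Computing 6 (1996)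
113) computed the whole spectrum of the independence sampler and found it in `[0, 1]` — and is
named here, not cited as a tree fact.

## Content

The frozen scorer A 0.1.2's `V9:tau-below-sticking-floor` test compares a measured
`τ̂_int(1_A)` with the floor `½ + Σ_{t≥1} (bᵗ − p)₊/(1 − p)` (`Scoring/StickingFloor`).  The bound
`ρ_t ≥ (bᵗ − p)/(1 − p)` is theory-2's T2-R′ (`Exactness.sector_joint_lower_bound`); the POSITIVE
PART additionally uses `ρ_t ≥ 0`, listed in `Scoring/StickingFloor` and in
HOME/eng-scorera/LEAN-COVERAGE-A.md as the one input of the scorer's formulas not yet in the tree.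
This file proves it for the exact flow-MCMC chain `imhKernel p q` on a finite state space:

* `minKernel_quadratic_ge`, `minKernel_psd` — the kernel `min (a x) (a y)` (`a ≥ 0`) is positive
  semidefinite: `Σ_{x,y} u_x u_y min(a_x, a_y) ≥ (min a)·(Σ u)² ≥ 0`, by inserting the states in
  decreasing order of `a` (`Finset.induction_on_min_value`) — the finite layer-cake argument;
* `mul_imhKernel_of_ne`, `symFlow_eq` — off the diagonal `p(x) P(x,y) = min(p_x q_y, p_y q_x)
  = p_x p_y · min(q_x/p_x, q_y/p_y)`: the symmetrised flow of IMH is a `min` kernel in the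
  likelihood ratios `a = q/p`;
* `imh_quadratic_form_eq`, `imh_quadratic_form_nonneg` — **one step**: `Σ_{x,y} p_x P(x,y) v_x v_y
  = Σ_x (p_x − Σ_z min(p_x q_z, p_z q_x)) v_x² + Σ_{x,y} min(p_x q_y, p_y q_x) v_x v_y ≥ 0`
  (the first bracket is `≥ p_x − p_x Σ_z q_z = 0`), i.e. `diag(p)·P` is positive semidefinite —
  the operator `P` is positive on `ℓ²(p)`;
* `twoTime`, `twoTime_symm`, `twoTime_self_nonneg` — **t steps**: the two-time form
  `S_t(f, g) = Σ_{x,y} p_x Pᵗ(x,y) f_x g_y` is symmetric (detailed balance) and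
  `S_{2s}(f,f) = S_0(Pˢf, Pˢf) ≥ 0`, `S_{2s+1}(f,f) = S_1(Pˢf, Pˢf) ≥ 0` — no spectral theorem needed;
* `lawAt_single_eq_pow` — the tree's `lawAt P (Pi.single x 1) t y` IS the matrix power `Pᵗ(x,y)`,
  so the result reads on T2-R′'s own objects: `imh_twoTime_lawAt_nonneg`, and for a sector
  indicator centred at any constant, `imh_sector_autocov_nonneg` —
  **`Cov_p(1_A(X₀), 1_A(X_t)) ≥ 0` for every `t` and every set `A`**, which is the `ρ_t ≥ 0` that
  `Scoring.StickingFloor.stickingFloor_le_tauInt` takes as hypothesis `hpos`.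
-/

namespace Summit.Ventures.LatticeQCDFlow.Scoring

open Finset Literature.Probability.MarkovChains Summit.Ventures.LatticeQCDFlow.Exactness

variable {X : Type*} [Fintype X] [DecidableEq X]

/-! ### The `min` kernel is positive semidefinite (finite layer cake) -/

omit [Fintype X] in
/-- For `0 ≤ m ≤ a` on `s`: `m · (Σ_{x∈s} u_x)² ≤ Σ_{x,y∈s} u_x u_y min(a_x, a_y)`.  Proof by
inserting the states in decreasing order of `a`: the newly inserted state `z` has the smallest
value, so every new `min` equals `a_z` and the form grows by `a_z((u_z + S)² − S²)`. -/
theorem minKernel_quadratic_ge (a u : X → ℝ) (s : Finset X) :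
    ∀ m : ℝ, 0 ≤ m → (∀ x ∈ s, m ≤ a x) →
      m * (∑ x ∈ s, u x) ^ 2 ≤ ∑ x ∈ s, ∑ y ∈ s, u x * u y * min (a x) (a y) := by
  refine Finset.induction_on_min_value a
    (motive := fun s => ∀ m : ℝ, 0 ≤ m → (∀ x ∈ s, m ≤ a x) →
      m * (∑ x ∈ s, u x) ^ 2 ≤ ∑ x ∈ s, ∑ y ∈ s, u x * u y * min (a x) (a y)) s ?_ ?_
  · intro m _ _
    simp
  · intro z s hz hmin IH m hm0 hm
    have hmz : m ≤ a z := hm z (mem_insert_self z s)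
    have haz : 0 ≤ a z := hm0.trans hmz
    have hIH := IH (a z) haz (fun x hx => hmin x hx)
    have h1 : ∑ y ∈ s, u z * u y * min (a z) (a y) = u z * a z * ∑ y ∈ s, u y := by
      rw [mul_sum]
      refine sum_congr rfl fun y hy => ?_
      rw [min_eq_left (hmin y hy)]
      ring
    have h2 : ∀ x ∈ s, ∑ y ∈ insert z s, u x * u y * min (a x) (a y)
        = u x * u z * a z + ∑ y ∈ s, u x * u y * min (a x) (a y) := by
      intro x hx
      rw [sum_insert hz, min_eq_right (hmin x hx)]
    have h3 : ∑ x ∈ s, u x * u z * a z = u z * a z * ∑ x ∈ s, u x := by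
      rw [mul_sum]
      refine sum_congr rfl fun x _ => ?_
      ring
    have hexp : ∑ x ∈ insert z s, ∑ y ∈ insert z s, u x * u y * min (a x) (a y)
        = u z * u z * a z + 2 * (u z * a z * ∑ x ∈ s, u x)
          + ∑ x ∈ s, ∑ y ∈ s, u x * u y * min (a x) (a y) := by
      rw [sum_insert hz, sum_insert hz, min_self, h1, sum_congr rfl h2, sum_add_distrib, h3]
      ring
    rw [sum_insert hz, hexp]
    have hsq : m * (u z + ∑ x ∈ s, u x) ^ 2 ≤ a z * (u z + ∑ x ∈ s, u x) ^ 2 :=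
      mul_le_mul_of_nonneg_right hmz (sq_nonneg _)
    nlinarith [hIH, hsq, sq_nonneg (u z + ∑ x ∈ s, u x)]

/-- **The `min` kernel is positive semidefinite**: for `a ≥ 0`,
`0 ≤ Σ_{x,y} u_x u_y min(a_x, a_y)`. -/
theorem minKernel_psd (a u : X → ℝ) (ha : ∀ x, 0 ≤ a x) :
    0 ≤ ∑ x, ∑ y, u x * u y * min (a x) (a y) := by
  have h := minKernel_quadratic_ge a u univ 0 le_rfl (fun x _ => ha x)
  simpa using h

/-! ### One step: `diag(p)·P_IMH` is positive semidefinite -/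

/-- The symmetrised one-step flow of IMH: `min(p_x q_y, p_y q_x)`. -/
noncomputable def symFlow (p q : X → ℝ) (x y : X) : ℝ :=
  min (p x * q y) (p y * q x)

omit [Fintype X] [DecidableEq X] in
/-- `symFlow` is symmetric. -/
theorem symFlow_comm (p q : X → ℝ) (x y : X) : symFlow p q x y = symFlow p q y x := by
  unfold symFlow
  exact min_comm _ _

omit [Fintype X] [DecidableEq X] in
/-- `symFlow` is a `min` kernel in the likelihood ratios `a = q/p`, weighted by `p_x p_y`. -/
theorem symFlow_eq {p q : X → ℝ} (hp : ∀ x, 0 < p x) (x y : X) :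
    symFlow p q x y = p x * p y * min (q x / p x) (q y / p y) := by
  unfold symFlow
  rw [(monotone_mul_left_of_nonneg (mul_pos (hp x) (hp y)).le).map_min]
  have hx : p x ≠ 0 := (hp x).ne'
  have hy : p y ≠ 0 := (hp y).ne'
  have h1 : p x * p y * (q x / p x) = p y * q x := by
    field_simp
  have h2 : p x * p y * (q y / p y) = p x * q y := by
    field_simp
  rw [h1, h2]
  exact min_comm _ _

/-- Off the diagonal, `p_x · P(x,y) = min(p_x q_y, p_y q_x)`. -/
theorem mul_imhKernel_of_ne {p q : X → ℝ} (hp : ∀ x, 0 < p x) {x y : X} (h : y ≠ x) :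
    p x * imhKernel p q x y = symFlow p q x y := by
  unfold imhKernel symFlow
  rw [mhKernel_of_ne h, mul_mhRate hp]

/-- On the diagonal, `p_x · P(x,x) = p_x − Σ_{z ≠ x} min(p_x q_z, p_z q_x)`. -/
theorem mul_imhKernel_self {p q : X → ℝ} (hp : ∀ x, 0 < p x) (x : X) :
    p x * imhKernel p q x x = p x - ∑ z ∈ univ.erase x, symFlow p q x z := by
  unfold imhKernel symFlow
  rw [mhKernel_self, mul_sub, mul_one, mul_sum]
  congr 1
  exact sum_congr rfl fun z _ => mul_mhRate hp _ x z

omit [DecidableEq X] in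
/-- The total symmetrised flow out of `x` is at most `p_x` (`Σ q = 1`). -/
theorem sum_symFlow_le (p : X → ℝ) {q : X → ℝ} (hq1 : ∑ x, q x = 1) (x : X) :
    ∑ z, symFlow p q x z ≤ p x := by
  have h : ∑ z, symFlow p q x z ≤ ∑ z, p x * q z := sum_le_sum fun z _ => min_le_left _ _
  rw [← mul_sum, hq1, mul_one] at h
  exact h

/-- **The one-step quadratic form, decomposed**:
`Σ_{x,y} p_x P(x,y) v_x v_y = Σ_x (p_x − Σ_z min(p_x q_z, p_z q_x)) v_x² + Σ_{x,y} min(p_x q_y, p_y q_x) v_x v_y`. -/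
theorem imh_quadratic_form_eq {p q : X → ℝ} (hp : ∀ x, 0 < p x) (v : X → ℝ) :
    ∑ x, ∑ y, p x * imhKernel p q x y * v x * v y =
      ∑ x, (p x - ∑ z, symFlow p q x z) * v x ^ 2 + ∑ x, ∑ y, symFlow p q x y * v x * v y := by
  rw [← sum_add_distrib]
  refine sum_congr rfl fun x _ => ?_
  rw [← add_sum_erase univ (fun y => p x * imhKernel p q x y * v x * v y) (mem_univ x),
    ← add_sum_erase univ (fun z => symFlow p q x z) (mem_univ x),
    ← add_sum_erase univ (fun y => symFlow p q x y * v x * v y) (mem_univ x)]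
  have hoff : ∑ y ∈ univ.erase x, p x * imhKernel p q x y * v x * v y
      = ∑ y ∈ univ.erase x, symFlow p q x y * v x * v y :=
    sum_congr rfl fun y hy => by rw [mul_imhKernel_of_ne hp (ne_of_mem_erase hy)]
  have hdiag : p x * imhKernel p q x x * v x * v x
      = (p x - ∑ z ∈ univ.erase x, symFlow p q x z) * v x * v x := by
    rw [mul_imhKernel_self hp x]
  simp only [hoff, hdiag]
  ring

/-- **One step: `diag(p)·P_IMH ⪰ 0`** — the independence Metropolis operator is positive on
`ℓ²(p)` (`p > 0`, `q ≥ 0`, `Σ q = 1`). -/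
theorem imh_quadratic_form_nonneg {p q : X → ℝ} (hp : ∀ x, 0 < p x) (hq : ∀ x, 0 ≤ q x)
    (hq1 : ∑ x, q x = 1) (v : X → ℝ) :
    0 ≤ ∑ x, ∑ y, p x * imhKernel p q x y * v x * v y := by
  rw [imh_quadratic_form_eq hp v]
  refine add_nonneg (sum_nonneg fun x _ => mul_nonneg ?_ (sq_nonneg _)) ?_
  · linarith [sum_symFlow_le p hq1 x]
  · have hK : ∀ x y, symFlow p q x y * v x * v y
        = (v x * p x) * (v y * p y) * min (q x / p x) (q y / p y) := by
      intro x y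
      rw [symFlow_eq hp]
      ring
    simp_rw [hK]
    exact minKernel_psd _ _ (fun x => div_nonneg (hq x) (hp x).le)

/-! ### `t` steps: the two-time form is symmetric and positive -/

/-- Matrix action on functions: `(M g)(x) = Σ_y M x y · g y`. -/
def mv (M : Matrix X X ℝ) (g : X → ℝ) : X → ℝ := fun x => ∑ y, M x y * g y

omit [DecidableEq X] in
/-- `(A B) g = A (B g)`. -/
theorem mv_mul (A B : Matrix X X ℝ) (g : X → ℝ) : mv (A * B) g = mv A (mv B g) := by
  funext x
  simp only [mv, Matrix.mul_apply, sum_mul, mul_sum]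
  rw [sum_comm]
  exact sum_congr rfl fun z _ => sum_congr rfl fun y _ => by ring

/-- `1 g = g`. -/
theorem mv_one (g : X → ℝ) : mv (1 : Matrix X X ℝ) g = g := by
  funext x
  simp [mv, Matrix.one_apply]

/-- The two-time form `S_t(f, g) = Σ_x p_x f_x (Pᵗ g)_x = Σ_{x,y} p_x Pᵗ(x,y) f_x g_y`. -/
noncomputable def twoTime (p : X → ℝ) (M : Matrix X X ℝ) (t : ℕ) (f g : X → ℝ) : ℝ :=
  ∑ x, p x * f x * mv (M ^ t) g x

/-- `S_t` as a double sum. -/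
theorem twoTime_eq_sum (p : X → ℝ) (M : Matrix X X ℝ) (t : ℕ) (f g : X → ℝ) :
    twoTime p M t f g = ∑ x, ∑ y, p x * (M ^ t) x y * f x * g y := by
  unfold twoTime mv
  refine sum_congr rfl fun x _ => ?_
  rw [mul_sum]
  exact sum_congr rfl fun y _ => by ring

/-- `S_0(f, g) = Σ_x p_x f_x g_x`. -/
theorem twoTime_zero (p : X → ℝ) (M : Matrix X X ℝ) (f g : X → ℝ) :
    twoTime p M 0 f g = ∑ x, p x * f x * g x := by
  simp [twoTime, mv_one]

/-- `S_{t+1}(f, g) = S_t(f, P g)`. -/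
theorem twoTime_succ_right (p : X → ℝ) (M : Matrix X X ℝ) (t : ℕ) (f g : X → ℝ) :
    twoTime p M (t + 1) f g = twoTime p M t f (mv M g) := by
  simp only [twoTime, pow_succ, mv_mul]

omit [DecidableEq X] in
/-- One-step self-adjointness on `ℓ²(p)` from detailed balance: `⟨f, P h⟩_p = ⟨P f, h⟩_p`. -/
theorem inner_mv_comm {p : X → ℝ} {M : Matrix X X ℝ} (hDB : ∀ x y, p x * M x y = p y * M y x)
    (f h : X → ℝ) : ∑ x, p x * f x * mv M h x = ∑ x, p x * mv M f x * h x := by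
  have lhs : ∑ x, p x * f x * mv M h x = ∑ x, ∑ y, p x * M x y * f x * h y := by
    refine sum_congr rfl fun x _ => ?_
    rw [mv, mul_sum]
    exact sum_congr rfl fun y _ => by ring
  have rhs : ∑ x, p x * mv M f x * h x = ∑ x, ∑ y, p y * M y x * f x * h y := by
    rw [sum_comm]
    refine sum_congr rfl fun y _ => ?_
    rw [mv, mul_sum, sum_mul]
    exact sum_congr rfl fun x _ => by ring
  rw [lhs, rhs]
  exact sum_congr rfl fun x _ => sum_congr rfl fun y _ => by rw [hDB x y]

/-- `S_{t+1}(f, g) = S_t(P f, g)` (detailed balance). -/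
theorem twoTime_succ_left {p : X → ℝ} {M : Matrix X X ℝ}
    (hDB : ∀ x y, p x * M x y = p y * M y x) (t : ℕ) (f g : X → ℝ) :
    twoTime p M (t + 1) f g = twoTime p M t (mv M f) g := by
  unfold twoTime
  rw [pow_succ', mv_mul]
  exact inner_mv_comm hDB f (mv (M ^ t) g)

/-- **Symmetry**: `S_t(f, g) = S_t(g, f)` for every `t` (detailed balance). -/
theorem twoTime_symm {p : X → ℝ} {M : Matrix X X ℝ}
    (hDB : ∀ x y, p x * M x y = p y * M y x) :
    ∀ (t : ℕ) (f g : X → ℝ), twoTime p M t f g = twoTime p M t g f := by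
  intro t
  induction t with
  | zero =>
    intro f g
    rw [twoTime_zero, twoTime_zero]
    exact sum_congr rfl fun x _ => by ring
  | succ t ih =>
    intro f g
    rw [twoTime_succ_left hDB, ih, ← twoTime_succ_right]

/-- `S_{t+s}(f, g) = S_t(f, Pˢ g)`. -/
theorem twoTime_add_right (p : X → ℝ) (M : Matrix X X ℝ) (t : ℕ) (f : X → ℝ) :
    ∀ (s : ℕ) (g : X → ℝ), twoTime p M (t + s) f g = twoTime p M t f ((mv M)^[s] g) := by
  intro s
  induction s with
  | zero => intro g; simp
  | succ s ih =>
    intro g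
    rw [← add_assoc, twoTime_succ_right, ih, Function.iterate_succ_apply]

/-- `S_{s+t}(f, g) = S_t(Pˢ f, g)` (detailed balance). -/
theorem twoTime_add_left {p : X → ℝ} {M : Matrix X X ℝ}
    (hDB : ∀ x y, p x * M x y = p y * M y x) (t : ℕ) (g : X → ℝ) :
    ∀ (s : ℕ) (f : X → ℝ), twoTime p M (s + t) f g = twoTime p M t ((mv M)^[s] f) g := by
  intro s
  induction s with
  | zero => intro f; simp
  | succ s ih =>
    intro f
    rw [Nat.succ_add, twoTime_succ_left hDB, ih, Function.iterate_succ_apply]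

/-- **`S_t(f, f) ≥ 0` for every `t`**, given detailed balance, `p ≥ 0` and the ONE-STEP
positivity `S_1(v, v) ≥ 0`: even `t = 2s` gives `S_0(Pˢf, Pˢf) = Σ p (Pˢf)² ≥ 0`, odd `t = 2s+1`
gives `S_1(Pˢf, Pˢf) ≥ 0`. -/
theorem twoTime_self_nonneg {p : X → ℝ} {M : Matrix X X ℝ} (hp0 : ∀ x, 0 ≤ p x)
    (hDB : ∀ x y, p x * M x y = p y * M y x) (h1 : ∀ v : X → ℝ, 0 ≤ twoTime p M 1 v v)
    (t : ℕ) (f : X → ℝ) : 0 ≤ twoTime p M t f f := by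
  obtain ⟨s, rfl | rfl⟩ := Nat.even_or_odd' t
  · -- t = 2s
    have hr := twoTime_add_right p M 0 ((mv M)^[s] f) s f
    rw [zero_add] at hr
    rw [two_mul, twoTime_add_left hDB s f s f, hr, twoTime_zero]
    exact sum_nonneg fun x _ => by
      have := hp0 x
      nlinarith [sq_nonneg (((mv M)^[s] f) x)]
  · -- t = 2s + 1
    rw [show 2 * s + 1 = s + (1 + s) by ring, twoTime_add_left hDB (1 + s) f s f,
      twoTime_add_right p M 1 _ s f]
    exact h1 _

/-! ### The exact IMH chain -/

/-- The IMH kernel as a matrix. -/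
noncomputable def imhMatrix (p q : X → ℝ) : Matrix X X ℝ := Matrix.of (imhKernel p q)

/-- Entries of `imhMatrix` are the kernel's. -/
@[simp] theorem imhMatrix_apply (p q : X → ℝ) (x y : X) : imhMatrix p q x y = imhKernel p q x y :=
  rfl

/-- `S_1(v, v)` of the IMH chain is the one-step quadratic form. -/
theorem imh_twoTime_one (p q : X → ℝ) (v : X → ℝ) :
    twoTime p (imhMatrix p q) 1 v v = ∑ x, ∑ y, p x * imhKernel p q x y * v x * v y := by
  rw [twoTime_eq_sum]
  simp

/-- **Nonnegative two-time form for exact IMH, every lag**: `S_t(f, f) ≥ 0` (`p > 0`, `q ≥ 0`,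
`Σ q = 1`). -/
theorem imh_twoTime_nonneg {p q : X → ℝ} (hp : ∀ x, 0 < p x) (hq : ∀ x, 0 ≤ q x)
    (hq1 : ∑ x, q x = 1) (t : ℕ) (f : X → ℝ) : 0 ≤ twoTime p (imhMatrix p q) t f f := by
  refine twoTime_self_nonneg (fun x => (hp x).le) ?_ ?_ t f
  · intro x y
    simp only [imhMatrix_apply]
    exact imhKernel_detailedBalance hp q x y
  · intro v
    rw [imh_twoTime_one]
    exact imh_quadratic_form_nonneg hp hq hq1 v

/-! ### In T2-R′'s vocabulary (`lawAt` from a point mass) -/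

/-- The tree's `t`-step law started from `δ_x` IS the matrix power: `(δ_x Pᵗ)(y) = Pᵗ(x, y)`. -/
theorem lawAt_single_eq_pow (P : X → X → ℝ) (x : X) :
    ∀ (t : ℕ) (y : X), lawAt P (Pi.single x 1) t y = ((Matrix.of P) ^ t) x y := by
  intro t
  induction t with
  | zero =>
    intro y
    rw [lawAt_zero, pow_zero, Matrix.one_apply, Pi.single_apply]
    simp only [eq_comm]
  | succ t ih =>
    intro y
    rw [lawAt_succ, pow_succ, Matrix.mul_apply]
    unfold stepLaw
    exact sum_congr rfl fun z _ => by rw [ih z, Matrix.of_apply]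

/-- **`Σ_{x,y} p_x · P(X_t = y | X_0 = x) · g_x g_y ≥ 0`** for the exact IMH chain, every lag `t`
and every test function `g` — the two-time form on the objects of
`Exactness.sector_joint_lower_bound`. -/
theorem imh_twoTime_lawAt_nonneg {p q : X → ℝ} (hp : ∀ x, 0 < p x) (hq : ∀ x, 0 ≤ q x)
    (hq1 : ∑ x, q x = 1) (t : ℕ) (g : X → ℝ) :
    0 ≤ ∑ x, ∑ y, p x * lawAt (imhKernel p q) (Pi.single x 1) t y * g x * g y := by
  have h := imh_twoTime_nonneg hp hq hq1 t g
  rw [twoTime_eq_sum] at h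
  have hrw : ∀ x y, p x * lawAt (imhKernel p q) (Pi.single x 1) t y * g x * g y
      = p x * ((imhMatrix p q) ^ t) x y * g x * g y := by
    intro x y
    rw [lawAt_single_eq_pow]
    rfl
  simp_rw [hrw]
  exact h

/-- **The lag-`t` autocovariance of a sector indicator under exact IMH is nonnegative.**  At
stationarity `P(X₀ = x, X_t = y) = p_x Pᵗ(x,y)`, so for the indicator of any set `A` centred at
any constant `c` (its mean `p(A)` in the application),
`Cov = Σ_{x,y} p_x Pᵗ(x,y) (1_A(x) − c)(1_A(y) − c) ≥ 0`: the `ρ_t ≥ 0` that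
`Scoring.StickingFloor.stickingFloor_le_tauInt` takes as hypothesis `hpos`. -/
theorem imh_sector_autocov_nonneg {p q : X → ℝ} (hp : ∀ x, 0 < p x) (hq : ∀ x, 0 ≤ q x)
    (hq1 : ∑ x, q x = 1) (A : Finset X) (c : ℝ) (t : ℕ) :
    0 ≤ ∑ x, ∑ y, p x * lawAt (imhKernel p q) (Pi.single x 1) t y *
      ((if x ∈ A then 1 else 0) - c) * ((if y ∈ A then 1 else 0) - c) :=
  imh_twoTime_lawAt_nonneg hp hq hq1 t (fun x => (if x ∈ A then 1 else 0) - c)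

/-- Hence every normalised autocorrelation `ρ_t = C_t / C_0` of the chain is `≥ 0`. -/
theorem imh_acf_nonneg {p q : X → ℝ} (hp : ∀ x, 0 < p x) (hq : ∀ x, 0 ≤ q x)
    (hq1 : ∑ x, q x = 1) (g : X → ℝ) (t : ℕ) :
    0 ≤ (∑ x, ∑ y, p x * lawAt (imhKernel p q) (Pi.single x 1) t y * g x * g y) /
        (∑ x, ∑ y, p x * lawAt (imhKernel p q) (Pi.single x 1) 0 y * g x * g y) :=
  div_nonneg (imh_twoTime_lawAt_nonneg hp hq hq1 t g) (imh_twoTime_lawAt_nonneg hp hq hq1 0 g)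

end Summit.Ventures.LatticeQCDFlow.Scoring
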